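import Literature.AlgebraicGeometry.Modules.SheafHomFrames
import Literature.AlgebraicGeometry.Modules.DetClassOfIso
import HarnessLib

/-!
# The determinant class of the dual: `[det E^∨] = [det E]⁻¹` in `Ȟ¹(X, 𝒪_X^×)`, and `rk E^∨ = rk E`

Topic `AlgebraicGeometry/Modules`; namespace `Literature.AlgebraicGeometry.Modules`.  Cell hodgecm-mathlib (D-0151), rung-0
memo `B-plan/M1PRIME-DAG.md` P36 (1) (T1 library capital for J0a's Mumford bundle / `IsLambdaOfAt.of_fibreIso`).  THEOREMS + one
`FrameSystem`-valued construction (`FrameSystem.dual`, data); no named fact, no instance, no `sorry`.  HC_CM is proved only modulo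
the printed citations until rung 0 closes.

For a finite locally free `𝒪_X`-module `E` with a frame `e : 𝒪^I ≅ E|_W` the DUAL FRAME `e^∨ : 𝒪^I ≅ E^∨|_W` (★ `dualFrame`,
[Hartshorne1977] II Ex. 5.1 (b)) has as basis the dual basis `λ_i`; the transition matrix of two dual frames is the TRANSPOSE of the
transition matrix of the original frames taken in the opposite order, `T(e^∨, e'^∨) = T(e', e)ᵀ = (T(e, e')⁻¹)ᵀ` (the inverse
transpose), hence `det T(e^∨, e'^∨) = det T(e', e) = (det T(e, e'))⁻¹`: the determinant cocycle of the dual frame system is the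
INVERSE cocycle ([Hartshorne1977] II Ex. 5.16 (d)–(e), Ex. 6.11; [StacksProject] Tag 0FJI).

* `transition_dualFrame` — `T(e^∨, e'^∨)_{ij} = T(e', e)_{ji}`.
* `stdTransition_dualFrame`, `transitionDet_dualFrame` — `det T(e^∨, e'^∨) = det T(e', e)`.
* `FrameSystem.dual` — the dual frame system; `FrameSystem.dual_rank`, `FrameSystem.dual_cocycle` (`= F.cocycle.inv`).
* **`hasRank_dual`** — `HasRank E r → HasRank (dual E) r`.
* **`detClass_dual`** — `detClass (isFiniteLocallyFree_dual hE) = (detClass hE)⁻¹`.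

## References
* [Hartshorne1977] R. Hartshorne, *Algebraic Geometry*, GTM 52 (1977), II Ex. 5.1 (b), Ex. 5.16 (d)–(e), Ex. 6.11; III Ex. 4.5.
* [StacksProject] The Stacks project, Tag 0FJI (determinant of a finite locally free module), Tag 01C6.
-/

set_option autoImplicit false

noncomputable section

open CategoryTheory AlgebraicGeometry Opposite TopologicalSpace

namespace Literature.AlgebraicGeometry.Modules

open Literature.AlgebraicGeometry.Motives

universe u

variable {X : Scheme.{u}} {E : X.Modules}

/-! ### §1. Transition matrices of dual frames: the inverse transpose -/

section Transition

variable {W W' V : X.Opens} {I I' : Type u} [Fintype I] [Fintype I']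
  (e : SheafOfModules.free I ≅ E.over W) (e' : SheafOfModules.free I' ≅ E.over W')

/-- **`T(e^∨, e'^∨)_{ij} = T(e', e)_{ji}`**: the `i`-th coordinate of the dual basis section `λ'_j` in the dual frame of `e` is
`λ'_j(b_i)`, the `j`-th coordinate of `b_i` in the frame `e'` — the transition matrix of the dual frames is the transpose of the
opposite transition matrix (the inverse transpose of `T(e, e')`). [cite: Hartshorne1977, II Ex. 5.1 (b) and Ex. 5.16 (d)] -/
theorem transition_dualFrame (k : V ⟶ W) (k' : V ⟶ W') (i : I) (j : I') :
    transition (dualFrame e) (dualFrame e') k k' i j = transition e' e k' k j i := by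
  rw [transition_apply, basisSection_dualFrame, map_dualBasisSection, coord_dualFrame]
  change appLE (dualBasis (SheafOfModules.restrictTrivialisation (R := X.ringCatSheaf) k' e') j) (𝟙 V) _ = _
  rw [← restrictHom_dualBasis, appLE_restrictHom, Category.id_comp, transition_apply, coord_def]

variable {n n' : ℕ} (ε : I ≃ Fin n) (ε' : I' ≃ Fin n')

/-- The reindexed form: `stdT(e^∨, e'^∨)_{ab} = stdT(e', e)_{ba}`. [cite: Hartshorne1977, II Ex. 5.16 (d)] -/
theorem stdTransition_dualFrame (k : V ⟶ W) (k' : V ⟶ W') (a : Fin n) (b : Fin n') :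
    stdTransition (dualFrame e) (dualFrame e') ε ε' k k' a b = stdTransition e' e ε' ε k' k b a := by
  rw [stdTransition_apply, stdTransition_apply, transition_dualFrame]

/-- **`det T(e^∨, e'^∨) = det T(e', e)`** (`= (det T(e, e'))⁻¹`): determinants are transpose-invariant.
[cite: Hartshorne1977, II Ex. 5.16 (d)–(e)] -/
theorem transitionDet_dualFrame (k : V ⟶ W) (k' : V ⟶ W') :
    transitionDet (dualFrame e) (dualFrame e') ε ε' k k' = transitionDet e' e ε' ε k' k := by
  rcases subsingleton_or_nontrivial Γ(X, V) with hV | hV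
  · exact Subsingleton.elim _ _
  · obtain rfl : n = n' := rank_eq_of_nontrivial e e' ε ε' k k'
    rw [transitionDet_eq, transitionDet_eq, ← Matrix.det_transpose]
    congr 1
    ext a b
    rw [Matrix.transpose_apply, stdTransition_dualFrame]

end Transition

/-! ### §2. The dual frame system -/

namespace FrameSystem

variable (F : FrameSystem E)

/-- **The dual frame system**: same opens, index types and enumerations, frames the dual frames `(F.frame x)^∨`.
[cite: Hartshorne1977, II Ex. 5.1 (b)] -/
def dual : FrameSystem (Modules.dual E) where
  U := F.U
  mem := F.mem
  I := F.I
  rank := F.rank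
  enum := F.enum
  frame x :=
    letI : Fintype (F.I x) := Fintype.ofEquiv _ (F.enum x).symm
    dualFrame (F.frame x)

/-- The dual frame system has the same ranks (`rk E^∨ = rk E` frame by frame). [cite: Hartshorne1977, II Ex. 5.1 (b)] -/
theorem dual_rank (x : X) : F.dual.rank x = F.rank x := rfl

/-- **The determinant cocycle of the dual frame system is the inverse cocycle** `(x, y) ↦ g_{yx}`.
[cite: Hartshorne1977, II Ex. 5.16 (d)–(e)] -/
theorem dual_cocycle_g (x y : X) (V : X.Opens) (hx : V ≤ F.U x) (hy : V ≤ F.U y) :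
    F.dual.cocycle.g x y V hx hy = F.cocycle.g y x V hy hx := by
  letI : Fintype (F.I x) := Fintype.ofEquiv _ (F.enum x).symm
  letI : Fintype (F.I y) := Fintype.ofEquiv _ (F.enum y).symm
  rw [cocycle_g, cocycle_g]
  exact transitionDet_dualFrame (F.frame x) (F.frame y) (F.enum x) (F.enum y) (homOfLE hx) (homOfLE hy)

/-- Hence `[F^∨] = [F]⁻¹` in `Ȟ¹(X, 𝒪_X^×)`. [cite: Hartshorne1977, II Ex. 5.16 (e) and Ex. 6.11] -/
theorem mk_dual_cocycle : CechPic.mk F.dual.cocycle = (CechPic.mk F.cocycle)⁻¹ := by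
  rw [← CechPic.mk_inv]
  exact CechPic.sound (UnitCocycle.equiv_of_eq _ _ F.U F.mem (fun _ => le_rfl) (fun _ => le_rfl)
    fun x y V hx hy => (F.dual_cocycle_g x y V hx hy).symm)

end FrameSystem

/-! ### §3. Rank and determinant class of the dual -/

/-- **`rk E^∨ = rk E`**: the dual of a locally free module of rank `r` is locally free of rank `r` (dual frames).
[cite: Hartshorne1977, II Ex. 5.1 (b)] [cite: StacksProject, Tag 01C6] -/
theorem hasRank_dual {r : ℕ} (h : HasRank E r) : HasRank (Modules.dual E) r := by
  obtain ⟨F, hF⟩ := exists_frameSystem_of_hasRank h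
  exact F.dual.hasRank r hF

/-- **`[det E^∨] = [det E]⁻¹`** in `Ȟ¹(X, 𝒪_X^×)` for a finite locally free `E` (the classes computed from any proofs of local
freeness, ★ `detClass_congr`): the determinant cocycle of the dual frame system is the inverse cocycle.
[cite: Hartshorne1977, II Ex. 5.16 (e) and Ex. 6.11] [cite: StacksProject, Tag 0FJI] -/
theorem detClass_dual (hE : IsFiniteLocallyFree E) :
    detClass (isFiniteLocallyFree_dual hE) = (detClass hE)⁻¹ := by
  let F := frameSystemOfIsFiniteLocallyFree hE
  rw [detClass_eq_mk hE F, detClass_eq_mk (isFiniteLocallyFree_dual hE) F.dual]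
  exact F.mk_dual_cocycle

/-- The same with an arbitrary proof of local freeness of the dual. [cite: Hartshorne1977, II Ex. 6.11] -/
theorem detClass_dual' (hE : IsFiniteLocallyFree E) (hE' : IsFiniteLocallyFree (Modules.dual E)) :
    detClass hE' = (detClass hE)⁻¹ :=
  (detClass_congr hE' (isFiniteLocallyFree_dual hE)).trans (detClass_dual hE)

end Literature.AlgebraicGeometry.Modules

end
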